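import Mathlib
import Summits.ValiantsHypothesis.ValiantsHypothesis.Theorems.DetQPDetqpSuperquadraticStubZariskiLimit
import Summits.ValiantsHypothesis.ValiantsHypothesis.Theorems.DetQPDetqpSuperquadraticStubInitialFormFamily
import Summits.ValiantsHypothesis.ValiantsHypothesis.Theorems.DetQPDetqpSuperquadraticStubKrylovAdjugateOrder
import Literature.Computability.AlgebraicComplexity.OrbitClosureProofs
import Literature.Computability.AlgebraicComplexity.DeterminantalComplexityProofs
import Literature.Computability.AlgebraicComplexity.StandardFamiliesProofs
import Literature.Barriers.ValiantsHypothesis.GCTMatrixPoweringGrenet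

/-!
# Crux `DetQP.DetqpSuperquadratic` (stmt-ValiantsHypothesis-0318), line `linear-homogenisation-transfer` —
stub `stub_krylovBorder` (B4) and THE BORDER SANDWICH `bdc(per_n) ≤ kw(per_n) + 1 ≤ dc(per_n)`

The line (cards `Cruxes/DetqpSuperquadratic/Ideas/linear-homogenisation-transfer.md`, `vertex-power-width.md`;
Chatterjee–Kumar–Volk 2024 Thm 13) reduces the crux `dc(per_n) ≥ n^(2+ε)` to a width statement (stub S3)
about KRYLOV NORMAL FORMS of the permanent: homogeneous linear `ρ, γ ∈ (S¹)^w`, `L ∈ M_w(S¹)`,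
`S = ℂ[x_ij]`, with (A3) `ρᵀ L^(n−2) γ = per_n` and (A2) `ρᵀ Lʲ γ = 0` for `j < n − 2` (and (A4), unused
here).  Every determinantal expression of size `w + 1` yields one (stubs S1a, S1b, landed), so
`kw(per_n) ≤ dc(per_n) − 1` and S3 implies the crux.  This file bounds the Krylov class FROM ABOVE:

* `stub_krylovBorder` (registered stub B4): a Krylov form of width `w` (`n ≥ 3`; only (A2), (A3) used) is a
  BORDER determinantal expression of size `w + 1`: `X₀₀^(w+1−n) per_n ∈ Δ[det_(w+1)] = \overline{GL · det}`.
  Proof: `A = [[0, −ρᵀ],[γ, 1 − L]]` is affine of size `w + 1` with `det A = ρᵀ adj(1−L) γ = per_n +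
  (degree ≥ n+1)` (stub B3 `stub_krylovAdjugateOrder`, landed), and the INITIAL FORM of a polynomial with an
  affine determinantal expression of size `m` is a degeneration of `det_m`
  (`KrylovBorder.hasBorderDetRepr_of_initialForm`: homogenise with `X₀₀` and rescale — stub B2
  `stub_initialFormFamily`, landed — then let `t → 0` in the Zariski topology — stub B1 `stub_zariskiLimit`,
  landed).
* `borderDetComplexityPer_le_of_krylov`: hence `bdc(per_n) ≤ w + 1` for every Krylov form of width `w`.
* `krylovWidthSuperquadratic_of_borderSuperquadratic`: the BORDER crux (`n^(2+ε) ≤ bdc(per_n)` eventually)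
  implies the registered transfer stub S3 verbatim.  With the skeleton's `DetqpSuperquadratic_of`
  (S3 ⟹ crux) the open stub of the line is sandwiched between the crux and its border (GCT) version: the
  Krylov relaxation buys at most the gap `dc − bdc`, and every border lower-bound technique (and its
  ceiling) applies to it.

New relative to the line's cards, the triage r1 and the Disproof (v7), which compare the Krylov class with
`dc` from below only.
-/

noncomputable section

-- `Summit.ValiantsHypothesis.ValiantsHypothesis.…` is the tree's mandated single-conjunct layout (Sub = Summit).
set_option linter.dupNamespace false

namespace Summit.ValiantsHypothesis.ValiantsHypothesis.Theorems.DetQPDetqpSuperquadratic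

open MvPolynomial Matrix
open Literature.Computability.AlgebraicComplexity


namespace KrylovBorder

/-- **Cayley–Hamilton forces `w + 1 ≥ n`** (same statement and proof as the landed
`KrylovFloor.width_ge_of_krylov`, p87997, restated here to keep this file independent of that module):
a Krylov presentation `ρᵀ L^(m+1) γ = f ≠ 0` with `ρᵀ Lʲ γ = 0` for `j < m + 1` has width `w ≥ m + 2`,
else `L^(m+1)` is a combination of lower powers. [folklore] -/
theorem width_ge_of_krylov {S : Type*} [CommRing S] [Nontrivial S] {m w : ℕ}
    (ρ γ : Fin w → S) (L : Matrix (Fin w) (Fin w) S) {f : S} (hf : f ≠ 0)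
    (hA3 : ρ ⬝ᵥ (L ^ (m + 1) *ᵥ γ) = f) (hA2 : ∀ j : ℕ, j < m + 1 → ρ ⬝ᵥ (L ^ j *ᵥ γ) = 0) :
    m + 2 ≤ w := by
  by_contra hlt
  push Not at hlt
  have hCH := Matrix.aeval_self_charpoly L
  rw [Polynomial.aeval_eq_sum_range, Matrix.charpoly_natDegree_eq_dim, Fintype.card_fin] at hCH
  have h0 : ρ ⬝ᵥ ((L ^ (m + 1 - w) * ∑ k ∈ Finset.range (w + 1), L.charpoly.coeff k • L ^ k) *ᵥ γ)
      = 0 := by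
    rw [hCH, Matrix.mul_zero, Matrix.zero_mulVec, dotProduct_zero]
  rw [Finset.mul_sum, Matrix.sum_mulVec, dotProduct_sum, Finset.sum_range_succ,
    Finset.sum_eq_zero, zero_add, Matrix.mul_smul, ← pow_add,
    show m + 1 - w + w = m + 1 by omega, Matrix.smul_mulVec, dotProduct_smul, hA3] at h0
  · have hmon : L.charpoly.coeff w = 1 := by
      have h := L.charpoly_monic.coeff_natDegree
      rwa [Matrix.charpoly_natDegree_eq_dim, Fintype.card_fin] at h
    rw [hmon, one_smul] at h0
    exact hf h0
  · intro k hk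
    rw [Matrix.mul_smul, ← pow_add, Matrix.smul_mulVec, dotProduct_smul,
      hA2 _ (by have := Finset.mem_range.1 hk; omega), smul_zero]

/-- Krylov data (A2), (A3) for `per_n`, `n ≥ 3`, have `n ≤ w + 1` (Cayley–Hamilton). [folklore] -/
theorem le_width_succ_of_krylov {n w : ℕ} (hn : 3 ≤ n)
    {ρ γ : Fin w → MvPolynomial (Fin n × Fin n) ℂ}
    {L : Matrix (Fin w) (Fin w) (MvPolynomial (Fin n × Fin n) ℂ)}
    (hA3 : ρ ⬝ᵥ ((L ^ (n - 2)) *ᵥ γ) = perPoly (Fin n) ℂ)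
    (hA2 : ∀ j : ℕ, j < n - 2 → ρ ⬝ᵥ ((L ^ j) *ᵥ γ) = 0) : n ≤ w + 1 := by
  obtain ⟨m, rfl⟩ : ∃ m, n = m + 3 := ⟨n - 3, by omega⟩
  rw [show m + 3 - 2 = m + 1 from rfl] at hA3 hA2
  have h := width_ge_of_krylov ρ γ L (perPoly_ne_zero _ _) hA3 hA2
  omega

/-- **The initial form of an affine determinantal expression is a degeneration of the determinant.**
If `F = det A` with `A` affine of size `m ≥ n`, `F` has no homogeneous component of degree `< n`, and
its degree-`n` component is `per_n`, then `X₀₀^(m−n) per_n ∈ Δ[det_m]`, i.e. `HasBorderDetRepr ℂ n m`.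
Proof: for `m = n`, `F = per_n` and this is Mulmuley–Sohoni 2001 Prop. 4.4 (tree); for `m > n`, place the
variables in the bottom-right block, homogenise with `X₀₀` and rescale by `t` (`stub_initialFormFamily`:
`Σ_e tᵉ X₀₀^(m−n−e) F_(n+e)(X_ι) ∈ End·det_m` for `t ≠ 0`), then let `t → 0` in the Zariski topology
(`stub_zariskiLimit`). [folklore] -/
theorem hasBorderDetRepr_of_initialForm {n m : ℕ} [NeZero m] (F : MvPolynomial (Fin n × Fin n) ℂ)
    (hnm : n ≤ m) (hF : HasDetRepr F m) (hlow : ∀ d : ℕ, d < n → homogeneousComponent d F = 0)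
    (htop : homogeneousComponent n F = perPoly (Fin n) ℂ) : HasBorderDetRepr ℂ n m := by
  classical
  rcases Nat.eq_or_lt_of_le hnm with h | h
  · -- `m = n`: `F = per_n` itself
    subst h
    have hdeg : F.totalDegree ≤ n := totalDegree_le_of_hasDetRepr_holds hF
    have hdn : n ≤ F.totalDegree := by
      by_contra hlt
      rw [homogeneousComponent_eq_zero _ _ (by omega)] at htop
      exact perPoly_ne_zero _ _ htop.symm
    have hFeq : F = perPoly (Fin n) ℂ := by
      rw [← htop]
      conv_lhs => rw [← sum_homogeneousComponent F]
      rw [Finset.sum_eq_single_of_mem n (Finset.mem_range.2 (by omega))]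
      intro d hd hdn
      have hd' := Finset.mem_range.1 hd
      rcases Nat.lt_or_gt_of_ne hdn with hlt | hgt
      · exact hlow d hlt
      · exact homogeneousComponent_eq_zero _ _ (lt_of_le_of_lt hdeg hgt)
    rw [hFeq] at hF
    exact paddedPerPoly_mem_orbitClosure_detPoly_of_hasDetRepr_holds hF le_rfl
  · -- `n < m`: place the block, homogenise with `X₀₀`, rescale, take the Zariski limit
    set e : Fin n ≃ BlockIdx n m := (Fintype.equivFinOfCardEq (card_blockIdx hnm)).symm with he
    set ι : Fin n × Fin n → Fin m × Fin m := fun ij => ((e ij.1 : Fin m), (e ij.2 : Fin m)) with hι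
    have hy : ((0 : Fin m), (0 : Fin m)) ∉ Set.range ι := by
      rintro ⟨ij, hij⟩
      have h1 : ((e ij.1 : Fin m) : ℕ) = 0 := by
        have := congrArg Prod.fst hij
        simp only [hι] at this
        rw [this]; rfl
      have h2 := (e ij.1).2
      omega
    set P : ℕ → MvPolynomial (Fin m × Fin m) ℂ := fun e' =>
      X ((0 : Fin m), (0 : Fin m)) ^ (m - n - e') * rename ι (homogeneousComponent (n + e') F) with hP
    have hfam := stub_initialFormFamily n m F ι ((0 : Fin m), (0 : Fin m)) hy hnm hF hlow
    have hlim : P 0 ∈ orbitClosure (detPoly (Fin m) ℂ) := by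
      refine stub_zariskiLimit (Fin m × Fin m) (detPoly (Fin m) ℂ) P (m - n) fun t ht => ?_
      exact endOrbit_subset_orbitClosure_holds _ (hfam t ht)
    have hP0 : P 0 = paddedPerPoly ℂ n m := by
      simp only [hP, Nat.sub_zero, add_zero, htop]
      rw [paddedPerPoly, ← rename_perPoly_equiv e, rename_rename]
      rfl
    rwa [hP0] at hlim

end KrylovBorder

open KrylovBorder

/-- **Registered stub `stub_krylovBorder` of line `linear-homogenisation-transfer` — a Krylov form of width
`w` is a BORDER determinantal expression of size `w + 1`.**  For `n ≥ 3` and homogeneous linear `ρ, γ, L`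
with (A3) `ρᵀ L^(n−2) γ = per_n` and (A2) `ρᵀ Lʲ γ = 0` (`j < n − 2`): `X₀₀^(w+1−n) per_n ∈ Δ[det_(w+1)]`.
Proof: `F = ρᵀ adj(1−L) γ` is the determinant of the affine bordered matrix `[[0,−ρᵀ],[γ,1−L]]` of size
`w+1` and `F = per_n + (degree ≥ n+1)` (`stub_krylovAdjugateOrder`); apply
`hasBorderDetRepr_of_initialForm` (`n ≤ w + 1` by Cayley–Hamilton).  New (the line's cards, triage and
Disproof compare the Krylov class only with `dc` from below; this bounds it by `bdc` from above). -/
theorem stub_krylovBorder :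
    ∀ (n w : ℕ) (ρ γ : Fin w → MvPolynomial (Fin n × Fin n) ℂ)
      (L : Matrix (Fin w) (Fin w) (MvPolynomial (Fin n × Fin n) ℂ)),
      3 ≤ n → (∀ i, (ρ i).IsHomogeneous 1) → (∀ i, (γ i).IsHomogeneous 1) →
      (∀ i j, (L i j).IsHomogeneous 1) →
      ρ ⬝ᵥ ((L ^ (n - 2)) *ᵥ γ) = perPoly (Fin n) ℂ →
      (∀ j : ℕ, j < n - 2 → ρ ⬝ᵥ ((L ^ j) *ᵥ γ) = 0) →
      (haveI : NeZero (w + 1) := ⟨Nat.succ_ne_zero w⟩; HasBorderDetRepr ℂ n (w + 1)) := by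
  intro n w ρ γ L hn hρ hγ hL hA3 hA2
  haveI : NeZero (w + 1) := ⟨Nat.succ_ne_zero w⟩
  obtain ⟨hdet, hlow, htop⟩ := stub_krylovAdjugateOrder n w ρ γ L (by omega) hρ hγ hL hA3 hA2
  exact hasBorderDetRepr_of_initialForm _ (le_width_succ_of_krylov hn hA3 hA2) hdet hlow htop

/-- **The border sandwich, lower index**: `bdc(per_n) ≤ w + 1` for every Krylov form of width `w` of `per_n`
(`n ≥ 3`, only (A2), (A3) used).  With `kw(per_n) ≤ dc(per_n) − 1` (stubs S1a, S1b of the line: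
`stub_vertexGauge`, `stub_krylovIdentities`) this reads `bdc(per_n) ≤ kw(per_n) + 1 ≤ dc(per_n)`. -/
theorem borderDetComplexityPer_le_of_krylov {n w : ℕ} (hn : 3 ≤ n)
    {ρ γ : Fin w → MvPolynomial (Fin n × Fin n) ℂ}
    {L : Matrix (Fin w) (Fin w) (MvPolynomial (Fin n × Fin n) ℂ)}
    (hρ : ∀ i, (ρ i).IsHomogeneous 1) (hγ : ∀ i, (γ i).IsHomogeneous 1)
    (hL : ∀ i j, (L i j).IsHomogeneous 1)
    (hA3 : ρ ⬝ᵥ ((L ^ (n - 2)) *ᵥ γ) = perPoly (Fin n) ℂ)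
    (hA2 : ∀ j : ℕ, j < n - 2 → ρ ⬝ᵥ ((L ^ j) *ᵥ γ) = 0) :
    borderDetComplexityPer ℂ n ≤ w + 1 :=
  Nat.sInf_le ⟨Nat.succ_pos w, le_width_succ_of_krylov hn hA3 hA2,
    stub_krylovBorder n w ρ γ L hn hρ hγ hL hA3 hA2⟩

/-- **The border sandwich, upper half: the BORDER crux implies the line's transfer stub S3** (registered v4
signature of `stub_krylovWidthSuperquadratic`, verbatim as conclusion).  If `n^(2+ε) ≤ bdc(per_n)` for all
large `n` (super-quadratic border determinantal complexity of the permanent), then every Krylov normal form of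
`per_n` of width `w` has `n^(2+ε) ≤ w + 1`.  Together with the line's composition (`S3 ⟹ crux`, skeleton
`DetqpSuperquadratic_of`) this places S3 between the crux `n^(2+ε) ≤ dc(per_n)` and its border version. -/
theorem krylovWidthSuperquadratic_of_borderSuperquadratic
    (hB : ∃ ε : ℝ, 0 < ε ∧ ∃ n₀ : ℕ, ∀ n ≥ n₀,
      (n : ℝ) ^ (2 + ε) ≤ (borderDetComplexityPer ℂ n : ℝ)) :
    ∃ ε : ℝ, 0 < ε ∧ ∃ n₀ : ℕ, ∀ n ≥ n₀, ∀ (w : ℕ)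
      (ρ γ : Fin w → MvPolynomial (Fin n × Fin n) ℂ)
      (L : Matrix (Fin w) (Fin w) (MvPolynomial (Fin n × Fin n) ℂ)),
      (∀ i, (ρ i).IsHomogeneous 1) → (∀ i, (γ i).IsHomogeneous 1) →
      (∀ i j, (L i j).IsHomogeneous 1) →
      ρ ⬝ᵥ ((L ^ (n - 2)) *ᵥ γ) = perPoly (Fin n) ℂ →
      (∀ j : ℕ, j < n - 2 → ρ ⬝ᵥ ((L ^ j) *ᵥ γ) = 0) →
      (∀ j : ℕ, perPoly (Fin n) ℂ ∣ ρ ⬝ᵥ ((L ^ j) *ᵥ γ)) →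
      Literature.Barriers.ValiantsHypothesis.HasPowTraceRepr ℂ (perPoly (Fin n) ℂ) n (2 * w + 1) →
      n ^ 2 ≤ 2 * w + 4 →
      (haveI : NeZero (w + 1) := ⟨Nat.succ_ne_zero w⟩; HasBorderDetRepr ℂ n (w + 1)) →
      (n : ℝ) ^ (2 + ε) ≤ (w : ℝ) + 1 := by
  obtain ⟨ε, hε, n₀, H⟩ := hB
  refine ⟨ε, hε, max n₀ 3, fun n hn w ρ γ L hρ hγ hL hA3 hA2 _ _ _ _ => ?_⟩
  have hn₀ : n₀ ≤ n := le_trans (le_max_left _ _) hn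
  have hn3 : 3 ≤ n := le_trans (le_max_right _ _) hn
  have hle' : (borderDetComplexityPer ℂ n : ℝ) ≤ (w : ℝ) + 1 := by
    exact_mod_cast borderDetComplexityPer_le_of_krylov hn3 hρ hγ hL hA3 hA2
  exact (H n hn₀).trans hle'

end Summit.ValiantsHypothesis.ValiantsHypothesis.Theorems.DetQPDetqpSuperquadratic
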